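import Literature.NumberTheory.Rogawski1990.UnitOrbitalIntegralInertValueTHEigenAdicCompletion      -- ★∕pending B-p12 p842264: `L_w` layer
import Literature.NumberTheory.Rogawski1990.FinExplicitTransferFactorKappaEvenEigenline              -- ★ B-p12 (β) p842227
import Literature.NumberTheory.Automorphic.UnitaryGroupFormTransportEigenvector                      -- ★ B-p12 (γ)-algebra p842239
import Literature.NumberTheory.Rogawski1990.LocalNormFibreSurjectiveNonsplit                         -- ★ `coe_localNonsplitEquiv_eq_map`
import Literature.NumberTheory.Rogawski1990.LocalNormFibreNonsplit                                   -- ★ `IsLocalNormPair.charpoly_eq`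
import Literature.NumberTheory.Rogawski1990.ExplicitFactorKappaAlmostEverywhereOne                   -- ★ `conjLocal_apply_eq_galAdicCompletionMap`
import Literature.NumberTheory.Automorphic.HyperspecialUnitaryParabolicBlocks                        -- ★ `antidiagonal_over_apply`
import HarnessLib

/-!
# κ = +1 VALUE IN THE STUB FRAME: `#Fix_{U(L_w)⧸K}(T δ_w T⁻¹) = phiTHn (Nv) n N` for a matching `δ` with `κ_v(γ_H, δ) = +1` (Flicker Thm. 18; Rogawski Prop. 4.9.1 (b))

Topic `NumberTheory/Rogawski1990`; namespace `Literature.NumberTheory.Rogawski1990`.  THEOREMS ONLY; kernel lane.  Cell `pub/hodgecm-mathlib`, road «N7-ns COUNT FROM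
FLICKER», line «N7nsCount», `stub_irredGValuePos` (:1189): bricks (β)+(γ) of LEAD F0P3a-plan (g9) T8-131 ASSEMBLED (B-p12 (g28)) — from a matching pair
`(γ_H, δ)` with `κ_v = +1`, `χ_g(u)` non-zero, the observable exponents `(n, N)` of the stub, and a congruence `T` with `H′_w = σ_w(T)ᵀ Φ₃ T` (★
`exists_glInt_placeForm_eq_formCongr_antidiagonal_of_isUnramifiedIn`): the element `t = T·δ_w·T⁻¹ ∈ U(σ_w, Φ₃)(L_w)` (= `localNonsplitEquiv Φ₃ (ψ δ)` for B-p14's congruence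
`ψ = localNonsplitCongr T`, ★ `localNonsplitEquiv_localNonsplitCongr`) has `#Fix_{U⧸K}(t) = phiTHn (Nv) n N`.  PROOF: ★ (β) gives a `γ₂`-eigenvector `p′` of `δ` whose
`H′_v`-value `ι_v x₀` has EVEN `ord_v`; its `w`-component `p′_w` is an eigenvector of `δ_w` and `T p′_w` one of `t` with `Φ₃`-value `ι_w x₀` (★ (γ)-algebra), of even
valuation (`e(w|v)·ord`); the exponents of `t` are those of `(g, u)` by ★ `IsLocalNormPair.charpoly_eq`; then ★ `natCard_fixedPoints_unitaryInt_eq_phiTHn_of_eigen_adicCompletion`.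
What the :1189 pen adds: the (P3) transport `Φ(⟦δ⟧, 1_{K′}) = #Fix(t)` ((α): ★ p04 + ★ F0P3-p02, `CompactSpace Z(δ)` from B-p10 (E4″)), `hfin`, `y`, `[IsAdicComplete]` (★ p842102).
HONEST LABEL: HC_CM is proved only modulo the printed citations (2 remaining named inputs hLiu418, h413) until rung 0 closes.

## References
* [Flicker1998UnitaryFL] Y. Z. Flicker, *Elementary proof of the fundamental lemma for a unitary group*, Canad. J. Math. 50 (1998), Theorem 18 p. 97.
* [Rogawski1990] J. D. Rogawski, *Automorphic Representations of Unitary Groups in Three Variables* (1990), §4.9 Prop. 4.9.1 (b) p. 55, §4.3 p. 43, §14.2 p. 233.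
-/

set_option autoImplicit false

noncomputable section

open NumberField IsDedekindDomain Matrix Polynomial
open scoped MatrixGroups WithZero Valued

namespace Literature.NumberTheory.Rogawski1990

open Literature.NumberTheory.Automorphic Literature.NumberTheory.Automorphic.UnitaryGroup
open Literature.NumberTheory.Automorphic.HermitianLattice
open Literature.NumberTheory.Rogawski1990.Flicker1998 (phiTHn)

variable (L : Type) [Field L] [NumberField L] [IsCMField L] (v : HeightOneSpectrum (𝓞 ↥(maximalRealSubfield L)))
  (H' : Matrix (Fin 3) (Fin 3) L)
  (a : (UnitaryGroup.cmDatum L 2 (Matrix.of fun i j : Fin 2 => if i.val + j.val + 1 = 2 then (1 : L) else 0)).Local v ×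
      (UnitaryGroup.cmDatum L 1 (Matrix.of fun i j : Fin 1 => if i.val + j.val + 1 = 1 then (1 : L) else 0)).Local v)
  (b : (UnitaryGroup.cmDatum L 3 H').Local v)

set_option maxHeartbeats 800000 in
-- coefficient bookkeeping on `charpoly`
/-- `tr` and `det` of a match: `charpoly δ = χ_g · (X − u)` ⇒ `tr δ = tr g + u`, `det δ = det g · u`. [cite: Rogawski1990, §4.3 p. 43] -/
theorem trace_det_of_isLocalNormPair (h : IsLocalNormPair L H' v a b) :
    (b.val.val : Matrix (Fin 3) (Fin 3) (UnitaryGroup.LocalRing L v)).trace =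
        (a.1.val.val : Matrix (Fin 2) (Fin 2) (UnitaryGroup.LocalRing L v)).trace + finGammaTwo L v a ∧
      (b.val.val : Matrix (Fin 3) (Fin 3) (UnitaryGroup.LocalRing L v)).det =
        (a.1.val.val : Matrix (Fin 2) (Fin 2) (UnitaryGroup.LocalRing L v)).det * finGammaTwo L v a := by
  haveI := UnitaryGroup.nontrivial_localRing L v
  have hχ := IsLocalNormPair.charpoly_eq L H' v h
  have hmg : (finCharpolyTwo L v a).Monic := Matrix.charpoly_monic _
  refine ⟨?_, ?_⟩
  · have h1 := Matrix.trace_eq_neg_charpoly_nextCoeff (b.val.val : Matrix (Fin 3) (Fin 3) (UnitaryGroup.LocalRing L v))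
    have h2 := Matrix.trace_eq_neg_charpoly_nextCoeff (a.1.val.val : Matrix (Fin 2) (Fin 2) (UnitaryGroup.LocalRing L v))
    rw [hχ, Polynomial.Monic.nextCoeff_mul hmg (monic_X_sub_C _), nextCoeff_X_sub_C] at h1
    rw [h1, h2, finCharpolyTwo]
    ring
  · have h1 := Matrix.det_eq_sign_charpoly_coeff (b.val.val : Matrix (Fin 3) (Fin 3) (UnitaryGroup.LocalRing L v))
    have h2 := Matrix.det_eq_sign_charpoly_coeff (a.1.val.val : Matrix (Fin 2) (Fin 2) (UnitaryGroup.LocalRing L v))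
    rw [hχ, Polynomial.mul_coeff_zero, coeff_sub, coeff_X_zero, coeff_C_zero, Fintype.card_fin] at h1
    rw [Fintype.card_fin] at h2
    rw [h1, h2, finCharpolyTwo]
    ring

set_option maxHeartbeats 1600000 in
set_option synthInstance.maxHeartbeats 200000 in
-- frame terms are large
/-- **κ = +1 VALUE IN THE STUB FRAME** (see the module docstring): for a matching `(γ_H, δ)` with `κ_v = +1` and a congruence `T` (`H′_w = σ_w(T)ᵀ Φ₃ T`), the element
`t` of `U(σ_w, Φ₃)(L_w)` with matrix `T δ_w T⁻¹` satisfies `#Fix_{U⧸K}(t) = phiTHn (Nv) n N`, `(n, N)` the stub's observable exponents. [cite: Flicker1998UnitaryFL, Theorem 18 p. 97]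
[cite: Rogawski1990, §4.9 Prop. 4.9.1 (b) p. 55] -/
theorem natCard_fixedPoints_eq_phiTHn_of_finKappaAt_eq_one (hH' : (H'.map (IsCMField.complexConj L))ᵀ = H')
    (w : UnitaryGroup.PlacesOver L v) (hw : IsCMField.complexConj L • w.1 = w.1)
    [IsAdicComplete (IsLocalRing.maximalIdeal 𝒪[w.1.adicCompletion L]) 𝒪[w.1.adicCompletion L]]
    (hv : Algebra.IsUnramifiedIn (𝓞 L) v.asIdeal) (h2 : (2 : 𝓞 ↥(maximalRealSubfield L)) ∉ v.asIdeal)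
    {y : w.1.adicCompletion L} (hy : y * galAdicCompletionMap (L := L) (IsCMField.complexConj L) hw y = -2)
    (h : IsLocalNormPair L H' v a b) (hu : IsUnit ((finCharpolyTwo L v a).eval (finGammaTwo L v a))) (hκ : finKappaAt L v H' a b = 1)
    {N n : ℕ}
    (hN : Valued.v ((((a.1.val : GL (Fin 2) (UnitaryGroup.LocalRing L v)).val.map
        (Pi.evalRingHom (fun w' : UnitaryGroup.PlacesOver L v => w'.1.adicCompletion L) w)).trace ^ 2 -
      4 * ((a.1.val : GL (Fin 2) (UnitaryGroup.LocalRing L v)).val.map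
        (Pi.evalRingHom (fun w' : UnitaryGroup.PlacesOver L v => w'.1.adicCompletion L) w)).det)) = WithZero.exp (-((2 * N + 1 : ℕ) : ℤ)))
    (hn : Valued.v (((finCharpolyTwo L v a).eval (finGammaTwo L v a)) w) = WithZero.exp (-(n : ℤ)))
    (T : GL (Fin 3) (w.1.adicCompletion L))
    (hT : UnitaryGroup.placeForm H' w.1 = formCongr (galAdicCompletionMap (L := L) (IsCMField.complexConj L) hw) T
      (UnitaryGroup.placeForm (Matrix.of fun i j : Fin 3 => if i.val + j.val + 1 = 3 then (1 : L) else 0) w.1))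
    {t : ↥(unitaryGroupOfForm (galAdicCompletionMap (L := L) (IsCMField.complexConj L) hw)
      (UnitaryGroup.placeForm (Matrix.of fun i j : Fin 3 => if i.val + j.val + 1 = 3 then (1 : L) else 0) w.1))}
    (ht : ((t : GL (Fin 3) (w.1.adicCompletion L)) : Matrix (Fin 3) (Fin 3) (w.1.adicCompletion L)) =
      (T : Matrix (Fin 3) (Fin 3) (w.1.adicCompletion L)) *
        ((b.val : GL (Fin 3) (UnitaryGroup.LocalRing L v)) : Matrix (Fin 3) (Fin 3) (UnitaryGroup.LocalRing L v)).map
          (Pi.evalRingHom (fun w' : UnitaryGroup.PlacesOver L v => w'.1.adicCompletion L) w) *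
        ((T⁻¹ : GL (Fin 3) (w.1.adicCompletion L)) : Matrix (Fin 3) (Fin 3) (w.1.adicCompletion L)))
    (hfin : {z : ↥(unitaryGroupOfForm (galAdicCompletionMap (L := L) (IsCMField.complexConj L) hw)
        (UnitaryGroup.placeForm (Matrix.of fun i j : Fin 3 => if i.val + j.val + 1 = 3 then (1 : L) else 0) w.1)) ⧸
      unitaryInt (galAdicCompletionMap (L := L) (IsCMField.complexConj L) hw)
        (UnitaryGroup.placeForm (Matrix.of fun i j : Fin 3 => if i.val + j.val + 1 = 3 then (1 : L) else 0) w.1) | t • z = z}.Finite) :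
    (Nat.card {z : ↥(unitaryGroupOfForm (galAdicCompletionMap (L := L) (IsCMField.complexConj L) hw)
        (UnitaryGroup.placeForm (Matrix.of fun i j : Fin 3 => if i.val + j.val + 1 = 3 then (1 : L) else 0) w.1)) ⧸
      unitaryInt (galAdicCompletionMap (L := L) (IsCMField.complexConj L) hw)
        (UnitaryGroup.placeForm (Matrix.of fun i j : Fin 3 => if i.val + j.val + 1 = 3 then (1 : L) else 0) w.1) | t • z = z} : ℚ) =
      phiTHn (Ideal.absNorm v.asIdeal) n N := by
  classical
  have hc1 : IsCMField.complexConj L ≠ 1 := IsCMField.complexConj_ne_one L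
  have hvs : Subsingleton (UnitaryGroup.PlacesOver L v) := UnitaryGroup.PlacesOver.subsingleton_of_smul_eq (IsCMField.complexConj L) hc1 w hw
  -- hermitian datum in the `cmConjRingHom` spelling
  have hH'c : (H'.map (cmConjRingHom L))ᵀ = H' := by
    have e1 : H'.map (cmConjRingHom L) = H'.map (IsCMField.complexConj L) := by
      ext i j; simp [Matrix.map_apply, cmConjRingHom_apply]
    rw [e1]; exact hH'
  -- (β): the eigenvector `p′`, its value `x₀`, non-zero of EVEN order
  obtain ⟨p', hne, hp'⟩ := exists_eigenvector_of_finKappaAt_ne_zero L v H' a b h (by rw [hκ]; exact one_ne_zero)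
  obtain ⟨x₀, hx₀⟩ := exists_toLocalRing_eq_formValue L v H' hH'c p'
  have hval0 := formValue_ne_zero_of_finKappaAt_eq_one L v H' a b hvs w hw h hu hp' hne hκ
  have hx₀0 : x₀ ≠ 0 := fun h0 => hval0 (by rw [← hx₀, h0, map_zero])
  have heven : Even (WithZero.log (Valued.v x₀)) := by
    have hite := finKappaAt_eq_ite_even_of_nonsplit_of_isUnramifiedIn L v H' a b w hw hv h hu hp' hne x₀ hx₀0 hx₀
    by_contra hodd
    rw [hκ, if_neg hodd] at hite
    norm_num at hite
  -- the `w`-components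
  set pw : Fin 3 → w.1.adicCompletion L := fun i => p' i w with hpw
  set δw : Matrix (Fin 3) (Fin 3) (w.1.adicCompletion L) :=
    ((b.val : GL (Fin 3) (UnitaryGroup.LocalRing L v)) : Matrix (Fin 3) (Fin 3) (UnitaryGroup.LocalRing L v)).map (Pi.evalRingHom (fun w' : UnitaryGroup.PlacesOver L v => w'.1.adicCompletion L) w) with hδw
  set uw : w.1.adicCompletion L := finGammaTwo L v a w with huw
  have hpw_eig : δw *ᵥ pw = uw • pw := by
    ext i
    have h1 := RingHom.map_mulVec (Pi.evalRingHom (fun w' : UnitaryGroup.PlacesOver L v => w'.1.adicCompletion L) w) ((b.val : GL (Fin 3) (UnitaryGroup.LocalRing L v)) : Matrix (Fin 3) (Fin 3) (UnitaryGroup.LocalRing L v)) p' i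
    rw [hp'] at h1
    have h2 : ((Pi.evalRingHom (fun w' : UnitaryGroup.PlacesOver L v => w'.1.adicCompletion L) w) ∘ p') = pw := by ext j; rfl
    rw [h2, ← hδw] at h1
    rw [← h1]
    simp [Pi.smul_apply, smul_eq_mul, hpw, huw]
  -- the element `t` and its eigenvector `x = T pw`
  set x : Fin 3 → w.1.adicCompletion L := (T : Matrix (Fin 3) (Fin 3) (w.1.adicCompletion L)) *ᵥ pw with hxdef
  have htx : ((t : GL (Fin 3) (w.1.adicCompletion L)) : Matrix (Fin 3) (Fin 3) (w.1.adicCompletion L)) *ᵥ x = uw • x := by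
    rw [ht, hxdef]; exact conj_mulVec_mulVec_eq_smul T hpw_eig
  -- the `Φ₃`-value of `x` is `ι_w x₀`
  have hΦ : UnitaryGroup.placeForm (Matrix.of fun i j : Fin 3 => if i.val + j.val + 1 = 3 then (1 : L) else 0) w.1 =
      (StdForm.antidiagonal 3).over (w.1.adicCompletion L) := by
    rw [UnitaryGroup.placeForm, UnitaryGroup.antidiagOne_eq_over, StdForm.over_map]
  have hB : B₀ (galAdicCompletionMap (L := L) (IsCMField.complexConj L) hw) 3 x x = UnitaryGroup.toPlace v w x₀ := by
    have e1 : B₀ (galAdicCompletionMap (L := L) (IsCMField.complexConj L) hw) 3 x x = ∑ i, ∑ k, (galAdicCompletionMap (L := L) (IsCMField.complexConj L) hw) (x i) *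
        (UnitaryGroup.placeForm (Matrix.of fun i j : Fin 3 => if i.val + j.val + 1 = 3 then (1 : L) else 0) w.1) i k * x k := by
      rw [B₀_apply, hΦ]
      refine Finset.sum_congr rfl fun i _ => ?_
      simp_rw [antidiagonal_over_apply, mul_ite, mul_one, mul_zero, ite_mul, zero_mul]
      rw [Finset.sum_ite_eq' Finset.univ (Fin.rev i)]
      simp
    rw [e1, hxdef, sum_map_mulVec_mul_mulVec_eq_of_formCongr_eq (galAdicCompletionMap (L := L) (IsCMField.complexConj L) hw) T hT.symm pw]
    -- the `w`-component of the `H′_v`-value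
    have e2 := congrFun hx₀ w
    rw [UnitaryGroup.toLocalRing_apply] at e2
    rw [e2]
    simp only [Finset.sum_apply, Pi.mul_apply, hpw]
    refine Finset.sum_congr rfl fun i _ => Finset.sum_congr rfl fun k _ => ?_
    rw [conjLocal_apply_eq_galAdicCompletionMap L v w hw, UnitaryGroup.adelicForm_map_adeleToLocal, Matrix.map_apply]
    rfl
  -- even valuation
  obtain ⟨j, hj⟩ := heven
  have hvx₀0 : Valued.v x₀ ≠ 0 := (Valuation.ne_zero_iff _).2 hx₀0
  have hx : Valued.v (B₀ (galAdicCompletionMap (L := L) (IsCMField.complexConj L) hw) 3 x x) = WithZero.exp (2 * (v.asIdeal.ramificationIdx' w.1.asIdeal * j : ℤ)) := by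
    rw [hB, UnitaryGroup.valued_toPlace, ← WithZero.exp_log hvx₀0, hj, ← WithZero.exp_nsmul, nsmul_eq_mul]
    congr 1; ring
  -- exponents of `t` from those of `(g, u)`
  obtain ⟨htr3, hdet3⟩ := trace_det_of_isLocalNormPair L v H' a b h
  have htr : Matrix.trace ((t : GL (Fin 3) (w.1.adicCompletion L)) : Matrix (Fin 3) (Fin 3) (w.1.adicCompletion L)) - uw =
      ((a.1.val : GL (Fin 2) (UnitaryGroup.LocalRing L v)).val.map (Pi.evalRingHom (fun w' : UnitaryGroup.PlacesOver L v => w'.1.adicCompletion L) w)).trace := by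
    rw [ht, Matrix.trace_units_conj T, hδw]
    have e1 : (((b.val : GL (Fin 3) (UnitaryGroup.LocalRing L v)) : Matrix (Fin 3) (Fin 3) (UnitaryGroup.LocalRing L v)).map (Pi.evalRingHom (fun w' : UnitaryGroup.PlacesOver L v => w'.1.adicCompletion L) w)).trace =
        (Pi.evalRingHom (fun w' : UnitaryGroup.PlacesOver L v => w'.1.adicCompletion L) w) ((b.val : GL (Fin 3) (UnitaryGroup.LocalRing L v)) : Matrix (Fin 3) (Fin 3) (UnitaryGroup.LocalRing L v)).trace := by
      simp [Matrix.trace, Matrix.map_apply]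
    have e2 : (((a.1.val : GL (Fin 2) (UnitaryGroup.LocalRing L v)).val).map (Pi.evalRingHom (fun w' : UnitaryGroup.PlacesOver L v => w'.1.adicCompletion L) w)).trace =
        (Pi.evalRingHom (fun w' : UnitaryGroup.PlacesOver L v => w'.1.adicCompletion L) w) (a.1.val.val : Matrix (Fin 2) (Fin 2) (UnitaryGroup.LocalRing L v)).trace := by
      simp [Matrix.trace, Matrix.map_apply]
    rw [e1, htr3, map_add, e2, huw]
    simp only [Pi.evalRingHom_apply]
    ring
  -- `u_w` is a unit, and `det t ∕ u_w = det g_w`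
  have huw_unit : IsUnit uw := by rw [huw, ← Pi.evalRingHom_apply _ w (finGammaTwo L v a)]; exact (isUnit_finGammaTwo L v a).map _
  have huw0 : uw ≠ 0 := huw_unit.ne_zero
  have hdet : Matrix.det ((t : GL (Fin 3) (w.1.adicCompletion L)) : Matrix (Fin 3) (Fin 3) (w.1.adicCompletion L)) / uw = ((a.1.val : GL (Fin 2) (UnitaryGroup.LocalRing L v)).val.map (Pi.evalRingHom (fun w' : UnitaryGroup.PlacesOver L v => w'.1.adicCompletion L) w)).det := by
    rw [ht, Matrix.det_units_conj T, hδw]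
    have e1 : ((b.val.val : Matrix (Fin 3) (Fin 3) (UnitaryGroup.LocalRing L v)).map (Pi.evalRingHom (fun w' : UnitaryGroup.PlacesOver L v => w'.1.adicCompletion L) w)).det = (Pi.evalRingHom (fun w' : UnitaryGroup.PlacesOver L v => w'.1.adicCompletion L) w) (b.val.val : Matrix (Fin 3) (Fin 3) _).det :=
      (RingHom.map_det (Pi.evalRingHom (fun w' : UnitaryGroup.PlacesOver L v => w'.1.adicCompletion L) w) _).symm
    have e2 : ((a.1.val : GL (Fin 2) (UnitaryGroup.LocalRing L v)).val.map (Pi.evalRingHom (fun w' : UnitaryGroup.PlacesOver L v => w'.1.adicCompletion L) w)).det = (Pi.evalRingHom (fun w' : UnitaryGroup.PlacesOver L v => w'.1.adicCompletion L) w) (a.1.val.val : Matrix (Fin 2) (Fin 2) (UnitaryGroup.LocalRing L v)).det :=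
      (RingHom.map_det (Pi.evalRingHom (fun w' : UnitaryGroup.PlacesOver L v => w'.1.adicCompletion L) w) _).symm
    rw [e1, hdet3, map_mul, e2, huw]
    simp only [Pi.evalRingHom_apply]
    rw [← huw]
    field_simp
  -- the observable `χ_g(u)` at `w`
  have hobs : uw ^ 2 - (Matrix.trace ((t : GL (Fin 3) (w.1.adicCompletion L)) : Matrix (Fin 3) (Fin 3) (w.1.adicCompletion L)) - uw) * uw + Matrix.det ((t : GL (Fin 3) (w.1.adicCompletion L)) : Matrix (Fin 3) (Fin 3) (w.1.adicCompletion L)) / uw = ((finCharpolyTwo L v a).eval (finGammaTwo L v a)) w := by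
    rw [htr, hdet, eval_finCharpolyTwo_finGammaTwo]
    have e2 : ((a.1.val : GL (Fin 2) (UnitaryGroup.LocalRing L v)).val.map (Pi.evalRingHom (fun w' : UnitaryGroup.PlacesOver L v => w'.1.adicCompletion L) w)).trace = (Pi.evalRingHom (fun w' : UnitaryGroup.PlacesOver L v => w'.1.adicCompletion L) w) (a.1.val.val : Matrix (Fin 2) (Fin 2) (UnitaryGroup.LocalRing L v)).trace := by
      simp [Matrix.trace, Matrix.map_apply]
    have e3 : ((a.1.val : GL (Fin 2) (UnitaryGroup.LocalRing L v)).val.map (Pi.evalRingHom (fun w' : UnitaryGroup.PlacesOver L v => w'.1.adicCompletion L) w)).det = (Pi.evalRingHom (fun w' : UnitaryGroup.PlacesOver L v => w'.1.adicCompletion L) w) (a.1.val.val : Matrix (Fin 2) (Fin 2) (UnitaryGroup.LocalRing L v)).det :=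
      (RingHom.map_det (Pi.evalRingHom (fun w' : UnitaryGroup.PlacesOver L v => w'.1.adicCompletion L) w) _).symm
    rw [e2, e3, huw]
    simp only [Pi.evalRingHom_apply, Pi.add_apply, Pi.sub_apply, Pi.mul_apply]
    ring
  have hN' : Valued.v ((Matrix.trace ((t : GL (Fin 3) (w.1.adicCompletion L)) : Matrix (Fin 3) (Fin 3) (w.1.adicCompletion L)) - uw) ^ 2 - 4 * (Matrix.det ((t : GL (Fin 3) (w.1.adicCompletion L)) : Matrix (Fin 3) (Fin 3) (w.1.adicCompletion L)) / uw)) = WithZero.exp (-((2 * N + 1 : ℕ) : ℤ)) := by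
    rw [htr, hdet]; exact hN
  have hn' : Valued.v (uw ^ 2 - (Matrix.trace ((t : GL (Fin 3) (w.1.adicCompletion L)) : Matrix (Fin 3) (Fin 3) (w.1.adicCompletion L)) - uw) * uw + Matrix.det ((t : GL (Fin 3) (w.1.adicCompletion L)) : Matrix (Fin 3) (Fin 3) (w.1.adicCompletion L)) / uw) = WithZero.exp (-(n : ℤ)) := by
    rw [hobs]; exact hn
  exact natCard_fixedPoints_unitaryInt_eq_phiTHn_of_eigen_adicCompletion L w hw hv h2 hy htx hx hN' hn' hfin

end Literature.NumberTheory.Rogawski1990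

end
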